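import Summits.NavierStokesRegularity.NavierStokesRegularity.Theorems.PerpetualPumpCircuitPumpGateFlipLemmas
import Summits.NavierStokesRegularity.NavierStokesRegularity.Theorems.PerpetualPumpCircuitPumpGateSigma

/-!
# Gate flip of the damped Toda transfer gate
# (crux `PerpetualPump.CircuitPump`, stmt-NavierStokesRegularity-1834;
# line `singular-clock-gspt`, sub-goal `toda_gate_flip` of `stub_clockBox`)

The active block of the Toda pump at the active scale, in raw units: old carrier `u`, bond `v`,
new carrier `w`, `u' = −u − v² + p`, `v' = v(u − w) − v + s`, `w' = −νw + v² + r` on `[0, T]`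
(`|p|, |r| ≤ P`, `0 ≤ s ≤ P`, `ν ∈ [1, 2]`, `T ≤ 1/2`, `u(0) = A ≥ 10⁴(1 + P)`, `w(0) ∈ [0, 1]`,
`v(0) ∈ (0, 1]`). With `D = u − w`, `R = √(D² + 2v²)`, `G = R + D`, `H = R − D` the gate ODE gives
`Ġ·R = −G(1 + H)R + ((ν−1)w + p − r)G + 2vs`, `Ḣ·R = H(G − 1)R − ((ν−1)w + p − r)H + 2vs`
(`flip_GH_deriv_bounds`, exact `linear_combination`s of the chain rule `Ṙ R = D Ḋ + 2 v v̇` and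
`R² = D² + 2v²`), hence `Ġ ≤ −G(1 + H − 3.03) + 2P`, `Ḣ ≥ H(G − 1 − 3.03)` as long as
`R ≥ A/3` and `(ν − 1)w + p − r ≤ 1.01A` — which the σ-lemma `toda_gate_sigma`
(`Theorems/PerpetualPumpCircuitPumpGateSigma.lean`) supplies on all of `[0, T]`
(`toda_gate_apriori_of_sigma`). The abstract continuity argument
`toda_gate_flip_dynamics` (`Theorems/PerpetualPumpCircuitPumpGateFlipLemmas.lean`) then yields the
**flip**: if at a time `tg` the bond holds `v ≥ R/8` with `D ≥ 0` and `tg + 250/A ≤ T`, then for all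
`t ∈ [tg + 250/A, T]` one has `D ≤ −(9/10)R` and `v(t) ≤ A e^{−(A/4)(t − tg − 250/A)} + 8P/A`
(`toda_gate_flip`). Everything here is folklore real analysis.
-/

noncomputable section

-- the summit namespace `…NavierStokesRegularity.NavierStokesRegularity…` is the tree convention
set_option linter.dupNamespace false

namespace Summit.NavierStokesRegularity.NavierStokesRegularity.Theorems.PerpetualPumpCircuitPump

open Set Filter Topology Literature.Analysis.ODE

/-- **Pointwise algebra of the gate variables.** With `D = u − w`, `R² = D² + 2v²`,
`R ≥ R₀ > 0`, and `Rd·R = D·Ḋ + 2v·v̇` (the chain rule for `R = √(D² + 2v²)` along the gate ODE: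
`Ḋ = (−u − v² + p) − (−νw + v² + r)`, `v̇ = v(u − w) − v + s`), the quantities `G = R + D`,
`H = R − D` satisfy EXACTLY `Ġ R = −G(1 + H)R + ((ν−1)w + p − r)G + 2vs` and
`Ḣ R = H(G − 1)R − ((ν−1)w + p − r)H + 2vs`; hence `Ġ ≤ −G(1 + H − X) + 2P` and
`Ḣ ≥ H(G − 1 − X)` whenever `(ν−1)w + p − r ≤ X R₀` (`X ≥ 0`), `0 ≤ s ≤ P`, `v ≥ 0`. [folklore] -/
theorem flip_GH_deriv_bounds {u v w p r s ν R Rd P X R₀ : ℝ} (hR₀ : 0 < R₀) (hR₀R : R₀ ≤ R)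
    (hRsq : R ^ 2 = (u - w) ^ 2 + 2 * v ^ 2) (hv : 0 ≤ v) (hs0 : 0 ≤ s) (hsP : s ≤ P)
    (hX : (ν - 1) * w + p - r ≤ X * R₀) (hX0 : 0 ≤ X)
    (hRd : Rd * R = (u - w) * ((-u - v ^ 2 + p) - (-ν * w + v ^ 2 + r)) +
      2 * v * (v * (u - w) - v + s)) :
    Rd + ((-u - v ^ 2 + p) - (-ν * w + v ^ 2 + r)) ≤
      -((R + (u - w)) * (1 + (R - (u - w)) - X)) + 2 * P ∧
    (R - (u - w)) * ((R + (u - w)) - 1 - X) ≤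
      Rd - ((-u - v ^ 2 + p) - (-ν * w + v ^ 2 + r)) := by
  have hRpos : 0 < R := lt_of_lt_of_le hR₀ hR₀R
  have hD2 : (u - w) ^ 2 ≤ R ^ 2 := by rw [hRsq]; nlinarith [sq_nonneg v]
  obtain ⟨hDlo, hDhi⟩ := abs_le_of_sq_le_sq' hD2 hRpos.le
  have hv2 : v ^ 2 ≤ R ^ 2 := by rw [hRsq]; nlinarith [sq_nonneg (u - w), sq_nonneg v]
  have hvR : v ≤ R := (abs_le_of_sq_le_sq' hv2 hRpos.le).2
  have hG0 : 0 ≤ R + (u - w) := by linarith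
  have hH0 : 0 ≤ R - (u - w) := by linarith
  have hEG : (Rd + ((-u - v ^ 2 + p) - (-ν * w + v ^ 2 + r))) * R =
      -(R + (u - w)) * (1 + (R - (u - w))) * R + ((ν - 1) * w + p - r) * (R + (u - w)) +
        2 * v * s := by
    linear_combination hRd + (1 + R) * hRsq
  have hEH : (Rd - ((-u - v ^ 2 + p) - (-ν * w + v ^ 2 + r))) * R =
      (R - (u - w)) * ((R + (u - w)) - 1) * R - ((ν - 1) * w + p - r) * (R - (u - w)) +
        2 * v * s := by
    linear_combination hRd + (1 - R) * hRsq
  have hXR : ∀ {Z : ℝ}, 0 ≤ Z → X * R₀ * Z ≤ X * Z * R := by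
    intro Z hZ
    have := mul_le_mul_of_nonneg_left hR₀R (mul_nonneg hX0 hZ)
    nlinarith [this]
  have h1 : ((ν - 1) * w + p - r) * (R + (u - w)) ≤ X * (R + (u - w)) * R :=
    (mul_le_mul_of_nonneg_right hX hG0).trans (hXR hG0)
  have h1' : ((ν - 1) * w + p - r) * (R - (u - w)) ≤ X * (R - (u - w)) * R :=
    (mul_le_mul_of_nonneg_right hX hH0).trans (hXR hH0)
  have h2 : 2 * v * s ≤ 2 * P * R := by nlinarith [mul_le_mul hvR hsP hs0 hRpos.le]
  have h3 : 0 ≤ 2 * v * s := by positivity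
  constructor
  · refine le_of_mul_le_mul_right ?_ hRpos
    rw [hEG]
    have : (-((R + (u - w)) * (1 + (R - (u - w)) - X)) + 2 * P) * R =
        -(R + (u - w)) * (1 + (R - (u - w))) * R + X * (R + (u - w)) * R + 2 * P * R := by
      ring
    linarith [this, h1, h2]
  · refine le_of_mul_le_mul_right ?_ hRpos
    rw [hEH]
    have : (R - (u - w)) * ((R + (u - w)) - 1 - X) * R =
        (R - (u - w)) * ((R + (u - w)) - 1) * R - X * (R - (u - w)) * R := by
      ring
    linarith [this, h1', h3]

/-- Chain rule for `G = R + D` and `H = R − D`, `R = √(D² + 2v²)`, `D = u − w`, at a point where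
`D² + 2v² > 0`. [folklore] -/
theorem flip_GH_hasDerivWithinAt {u v w : ℝ → ℝ} {u' v' w' t : ℝ} {S : Set ℝ}
    (hu : HasDerivWithinAt u u' S t) (hv : HasDerivWithinAt v v' S t)
    (hw : HasDerivWithinAt w w' S t) (hpos : 0 < (u t - w t) ^ 2 + 2 * v t ^ 2) :
    HasDerivWithinAt (fun x => Real.sqrt ((u x - w x) ^ 2 + 2 * v x ^ 2) + (u x - w x))
      (((u t - w t) * (u' - w') + 2 * v t * v') / Real.sqrt ((u t - w t) ^ 2 + 2 * v t ^ 2) +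
        (u' - w')) S t ∧
    HasDerivWithinAt (fun x => Real.sqrt ((u x - w x) ^ 2 + 2 * v x ^ 2) - (u x - w x))
      (((u t - w t) * (u' - w') + 2 * v t * v') / Real.sqrt ((u t - w t) ^ 2 + 2 * v t ^ 2) -
        (u' - w')) S t := by
  have hZ : HasDerivWithinAt (fun x => (u x - w x) ^ 2 + 2 * v x ^ 2)
      (2 * (u t - w t) * (u' - w') + 4 * v t * v') S t := by
    have h := ((hu.sub hw).fun_pow 2).add ((hv.fun_pow 2).const_mul 2)
    refine h.congr_deriv ?_
    simp only [Pi.sub_apply]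
    push_cast
    ring
  have hsqrt_pos : 0 < Real.sqrt ((u t - w t) ^ 2 + 2 * v t ^ 2) := Real.sqrt_pos.mpr hpos
  have hR : HasDerivWithinAt (fun x => Real.sqrt ((u x - w x) ^ 2 + 2 * v x ^ 2))
      (((u t - w t) * (u' - w') + 2 * v t * v') / Real.sqrt ((u t - w t) ^ 2 + 2 * v t ^ 2))
      S t := by
    refine (hZ.sqrt hpos.ne').congr_deriv ?_
    field_simp
    ring
  exact ⟨hR.add (hu.sub hw), hR.sub (hu.sub hw)⟩


/-- **The flip, given the a-priori gate bounds** (`v ≥ 0`, `A/3 ≤ R ≤ 3A/2`,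
`(ν−1)w + p − r ≤ 1.01A` on `[0,T]`): builds `G = R + D`, `H = R − D` along the gate ODE, checks the
differential inequalities of `flip_GH_deriv_bounds` and the initial sizes `G(tg) ≥ A/3`,
`H(tg) = 2v²/(R + D) ≥ R/64 ≥ A/192`, and reads the conclusion of `toda_gate_flip_dynamics` as
`D ≤ −(9/10)R` plus the bond decay. [folklore] -/
theorem toda_gate_flip_of_apriori {ν P T A tg : ℝ} {u v w p r s : ℝ → ℝ}
    (hP : 0 ≤ P) (hA : 10000 * (1 + P) ≤ A)
    (hu : ContinuousOn u (Icc 0 T)) (hv : ContinuousOn v (Icc 0 T))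
    (hw : ContinuousOn w (Icc 0 T))
    (hu' : ∀ t ∈ Ico 0 T, HasDerivWithinAt u (-u t - v t ^ 2 + p t) (Ici t) t)
    (hv' : ∀ t ∈ Ico 0 T, HasDerivWithinAt v (v t * (u t - w t) - v t + s t) (Ici t) t)
    (hw' : ∀ t ∈ Ico 0 T, HasDerivWithinAt w (-ν * w t + v t ^ 2 + r t) (Ici t) t)
    (hs : ∀ t ∈ Icc 0 T, 0 ≤ s t ∧ s t ≤ P)
    (htg : tg ∈ Icc 0 T) (htgT : tg + 250 / A ≤ T)
    (hgate : Real.sqrt ((u tg - w tg) ^ 2 + 2 * v tg ^ 2) / 8 ≤ v tg) (hD0 : 0 ≤ u tg - w tg)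
    (hap : ∀ t ∈ Icc 0 T, 0 ≤ v t ∧ A / 3 ≤ Real.sqrt ((u t - w t) ^ 2 + 2 * v t ^ 2) ∧
      Real.sqrt ((u t - w t) ^ 2 + 2 * v t ^ 2) ≤ 3 * A / 2 ∧
      (ν - 1) * w t + p t - r t ≤ 101 * A / 100) :
    ∀ t ∈ Icc (tg + 250 / A) T,
      u t - w t ≤ -(9 / 10) * Real.sqrt ((u t - w t) ^ 2 + 2 * v t ^ 2) ∧
      v t ≤ A * Real.exp (-(A / 4) * (t - (tg + 250 / A))) + 8 * P / A := by
  have hA' : 10000 ≤ A := by nlinarith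
  have hPA : 10000 * P ≤ A := by nlinarith
  have hApos : 0 < A := by linarith
  have hsubT : Icc tg T ⊆ Icc 0 T := Icc_subset_Icc_left htg.1
  set R : ℝ → ℝ := fun t => Real.sqrt ((u t - w t) ^ 2 + 2 * v t ^ 2) with hR
  set Dd : ℝ → ℝ := fun t => (-u t - v t ^ 2 + p t) - (-ν * w t + v t ^ 2 + r t) with hDd
  set Rd : ℝ → ℝ := fun t =>
    ((u t - w t) * Dd t + 2 * v t * (v t * (u t - w t) - v t + s t)) / R t with hRd
  -- pointwise facts on `[0, T]`
  have hRsq : ∀ t, R t ^ 2 = (u t - w t) ^ 2 + 2 * v t ^ 2 := fun t =>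
    Real.sq_sqrt (by positivity)
  have hDabs : ∀ t, |u t - w t| ≤ R t := fun t =>
    Real.abs_le_sqrt (by nlinarith [sq_nonneg (v t)])
  have hvR : ∀ t, v t ≤ R t := fun t =>
    Real.le_sqrt_of_sq_le (by nlinarith [sq_nonneg (u t - w t), sq_nonneg (v t)])
  have hRc : ContinuousOn R (Icc 0 T) :=
    (((hu.sub hw).pow 2).add ((hv.pow 2).const_mul 2)).sqrt
  -- the abstract flip
  have key := toda_gate_flip_dynamics A P tg T (fun t => R t + (u t - w t))
    (fun t => R t - (u t - w t)) v (fun t => Rd t + Dd t) (fun t => Rd t - Dd t)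
    (fun t => v t * (u t - w t) - v t + s t) hA' hP hPA
    ((hRc.add (hu.sub hw)).mono hsubT) ((hRc.sub (hu.sub hw)).mono hsubT) (hv.mono hsubT)
    ?_ ?_ (fun t ht => hv' t ⟨htg.1.trans ht.1, ht.2⟩) ?_ ?_ ?_
    (fun t ht => (hap t (hsubT ht)).1) ?_ ?_ ?_ ?_ ?_ ?_ htgT
  · -- read off the conclusion
    intro t ht
    obtain ⟨h1, h2⟩ := key t ht
    refine ⟨?_, h2⟩
    linarith
  · -- hGd
    intro t ht
    have ht' : t ∈ Ico 0 T := ⟨htg.1.trans ht.1, ht.2⟩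
    have hpos : 0 < (u t - w t) ^ 2 + 2 * v t ^ 2 :=
      Real.sqrt_pos.mp (by linarith [(hap t (Ico_subset_Icc_self ht')).2.1])
    exact (flip_GH_hasDerivWithinAt (hu' t ht') (hv' t ht') (hw' t ht') hpos).1
  · -- hHd
    intro t ht
    have ht' : t ∈ Ico 0 T := ⟨htg.1.trans ht.1, ht.2⟩
    have hpos : 0 < (u t - w t) ^ 2 + 2 * v t ^ 2 :=
      Real.sqrt_pos.mp (by linarith [(hap t (Ico_subset_Icc_self ht')).2.1])
    exact (flip_GH_hasDerivWithinAt (hu' t ht') (hv' t ht') (hw' t ht') hpos).2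
  · -- hG0
    intro t _
    have := (abs_le.mp (hDabs t)).1
    linarith
  · -- hH0
    intro t _
    have := (abs_le.mp (hDabs t)).2
    linarith
  · -- hsum
    intro t ht
    have := (hap t (hsubT ht)).2
    constructor <;> linarith
  · -- hvR
    intro t _
    have := hvR t
    linarith
  · -- hG'
    intro t ht
    have ht' : t ∈ Icc 0 T := hsubT (Ico_subset_Icc_self ht)
    obtain ⟨hv0, hRlo, -, hY⟩ := hap t ht'
    have hR3 : (0 : ℝ) < A / 3 := by positivity
    have hRne : R t ≠ 0 := by linarith
    have hRdR : Rd t * R t = (u t - w t) * Dd t + 2 * v t * (v t * (u t - w t) - v t + s t) :=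
      div_mul_cancel₀ _ hRne
    have hY' : (ν - 1) * w t + p t - r t ≤ 303 / 100 * (A / 3) := by linarith
    exact (flip_GH_deriv_bounds hR3 hRlo (hRsq t) hv0 (hs t ht').1 (hs t ht').2 hY'
      (by norm_num) hRdR).1
  · -- hH'
    intro t ht
    have ht' : t ∈ Icc 0 T := hsubT (Ico_subset_Icc_self ht)
    obtain ⟨hv0, hRlo, -, hY⟩ := hap t ht'
    have hR3 : (0 : ℝ) < A / 3 := by positivity
    have hRne : R t ≠ 0 := by linarith
    have hRdR : Rd t * R t = (u t - w t) * Dd t + 2 * v t * (v t * (u t - w t) - v t + s t) :=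
      div_mul_cancel₀ _ hRne
    have hY' : (ν - 1) * w t + p t - r t ≤ 303 / 100 * (A / 3) := by linarith
    exact (flip_GH_deriv_bounds hR3 hRlo (hRsq t) hv0 (hs t ht').1 (hs t ht').2 hY'
      (by norm_num) hRdR).2
  · -- hv'
    intro t ht
    have ht' : t ∈ Icc 0 T := hsubT (Ico_subset_Icc_self ht)
    have hsP := (hs t ht').2
    calc v t * (u t - w t) - v t + s t ≤ v t * (u t - w t) - v t + P := by linarith
      _ = v t * ((R t + (u t - w t) - (R t - (u t - w t))) / 2 - 1) + P := by ring
  · -- hGtg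
    have := (hap tg htg).2.1
    linarith
  · -- hHtg : A/192 ≤ R tg - D tg
    obtain ⟨-, hRlo, -, -⟩ := hap tg htg
    have hRpos : 0 < R tg := by linarith
    have hv2 : (R tg / 8) ^ 2 ≤ v tg ^ 2 := pow_le_pow_left₀ (by positivity) hgate 2
    have hprod : (R tg - (u tg - w tg)) * (R tg + (u tg - w tg)) = 2 * v tg ^ 2 := by
      have := hRsq tg; nlinarith [this]
    have hH0 : 0 ≤ R tg - (u tg - w tg) := by linarith [(abs_le.mp (hDabs tg)).2]
    have h1 : (R tg - (u tg - w tg)) * (R tg + (u tg - w tg)) ≤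
        (R tg - (u tg - w tg)) * (2 * R tg) := mul_le_mul_of_nonneg_left (by linarith) hH0
    have h2 : R tg / 64 * (2 * R tg) ≤ (R tg - (u tg - w tg)) * (2 * R tg) := by nlinarith
    have h3 : R tg / 64 ≤ R tg - (u tg - w tg) := le_of_mul_le_mul_right h2 (by linarith)
    linarith

/-- From the conclusions of the σ-lemma `toda_gate_sigma` at a time `t ≤ T ≤ 1/2` to the a-priori
inputs of `toda_gate_flip_of_apriori`: `R = S − σ ≤ A + 18 + 4.5P ≤ 3A/2` and, via `u ≥ σ/2`,
`w = S − u ≤ A + 9.5 + 3P`, so `(ν−1)w + p − r ≤ A + 9.5 + 5P ≤ 1.01A`. [folklore] -/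
theorem toda_gate_apriori_of_sigma {ν P A t U V W pp rr : ℝ} (hν1 : 1 ≤ ν) (hν2 : ν ≤ 2)
    (hP : 0 ≤ P) (hA : 10000 * (1 + P) ≤ A) (ht : t ≤ 1 / 2) (hp : |pp| ≤ P) (hr : |rr| ≤ P)
    (hS : U + W ≤ A + 1 + 3 * P * t)
    (hσ : |U + W - Real.sqrt ((U - W) ^ 2 + 2 * V ^ 2)| ≤ 2 + 15 * (ν - 1) + 6 * P * t) :
    Real.sqrt ((U - W) ^ 2 + 2 * V ^ 2) ≤ 3 * A / 2 ∧ (ν - 1) * W + pp - rr ≤ 101 * A / 100 := by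
  set R := Real.sqrt ((U - W) ^ 2 + 2 * V ^ 2) with hR
  have hDR : |U - W| ≤ R := Real.abs_le_sqrt (by nlinarith [sq_nonneg V])
  obtain ⟨hD1, hD2⟩ := abs_le.mp hDR
  obtain ⟨hσ1, hσ2⟩ := abs_le.mp hσ
  obtain ⟨-, hp2⟩ := abs_le.mp hp
  obtain ⟨hr1, -⟩ := abs_le.mp hr
  have hPt : P * t ≤ P / 2 := by nlinarith
  have hν' : 15 * (ν - 1) ≤ 15 := by linarith
  constructor
  · nlinarith
  · have hW : W ≤ A + 19 / 2 + 3 * P := by nlinarith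
    have hνW : (ν - 1) * W ≤ A + 19 / 2 + 3 * P := by
      rcases le_or_gt 0 W with h | h
      · calc (ν - 1) * W ≤ 1 * W := mul_le_mul_of_nonneg_right (by linarith) h
          _ ≤ A + 19 / 2 + 3 * P := by linarith
      · have : (ν - 1) * W ≤ 0 := mul_nonpos_of_nonneg_of_nonpos (by linarith) h.le
        nlinarith
    nlinarith

/-- **GATE FLIP LEMMA.** In the setting of `toda_gate_sigma` (with `A ≥ 10⁴(1+P)`): if at some
time `tg` the bond holds at least `1/8` of the gate radius (`v ≥ R/8`) with the old carrier still
ahead (`D = u − w ≥ 0`), then within time `250/A` the gate has FLIPPED — `D ≤ −(9/10) R` — and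
stays flipped, while the bond decays exponentially at rate `≥ A/4` down to the seed floor `8P/A`.
(Mechanism, in the variables `G = R + D`, `H = R − D`, `GH = 2v²`: `Ġ ≤ −G(H − 2.03) + 2P`,
`Ḣ ≥ H(G − 4.03)`; first `H` grows at rate `≥ 2A/13` until `G = A/6`, then `G` decays at rate
`≥ 2A/5` while `G ≤ A/5` persists; finally `D ≤ G − A/3` kills `v` at rate `≥ A/4`.)
[folklore] -/
theorem toda_gate_flip :
    ∀ (ν P T A tg : ℝ) (u v w p r s : ℝ → ℝ),
    1 ≤ ν → ν ≤ 2 → 0 ≤ P → 0 < T → T ≤ 1 / 2 → 10000 * (1 + P) ≤ A →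
    u 0 = A → 0 ≤ w 0 → w 0 ≤ 1 → 0 < v 0 → v 0 ≤ 1 →
    ContinuousOn u (Set.Icc 0 T) → ContinuousOn v (Set.Icc 0 T) → ContinuousOn w (Set.Icc 0 T) →
    (∀ t ∈ Set.Ico 0 T, HasDerivWithinAt u (-u t - v t ^ 2 + p t) (Set.Ici t) t) →
    (∀ t ∈ Set.Ico 0 T, HasDerivWithinAt v (v t * (u t - w t) - v t + s t) (Set.Ici t) t) →
    (∀ t ∈ Set.Ico 0 T, HasDerivWithinAt w (-ν * w t + v t ^ 2 + r t) (Set.Ici t) t) →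
    (∀ t ∈ Set.Icc 0 T, |p t| ≤ P) → (∀ t ∈ Set.Icc 0 T, |r t| ≤ P) →
    (∀ t ∈ Set.Icc 0 T, 0 ≤ s t ∧ s t ≤ P) →
    tg ∈ Set.Icc 0 T → tg + 250 / A ≤ T →
    Real.sqrt ((u tg - w tg) ^ 2 + 2 * v tg ^ 2) / 8 ≤ v tg → 0 ≤ u tg - w tg →
    ∀ t ∈ Set.Icc (tg + 250 / A) T,
      u t - w t ≤ -(9 / 10) * Real.sqrt ((u t - w t) ^ 2 + 2 * v t ^ 2) ∧
      v t ≤ A * Real.exp (-(A / 4) * (t - (tg + 250 / A))) + 8 * P / A := by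
  intro ν P T A tg u v w p r s hν1 hν2 hP hT0 hT hA hu0 hw0 hw1 hv0 hv1 hu hv hw hu' hv' hw' hp hr
    hs htg htgT hgate hD0
  have hsig := toda_gate_sigma ν P T A u v w p r s hν1 hν2 hP hT0 hT (by linarith) hu0 hw0 hw1
    hv0 hv1 hu hv hw hu' hv' hw' hp hr hs
  refine toda_gate_flip_of_apriori hP hA hu hv hw hu' hv' hw' hs htg htgT hgate hD0 ?_
  intro t ht
  obtain ⟨hv0t, -, -, hSup, hR3, hσ⟩ := hsig t ht
  obtain ⟨hRup, hY⟩ := toda_gate_apriori_of_sigma hν1 hν2 hP hA (ht.2.trans hT) (hp t ht) (hr t ht)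
    hSup hσ
  exact ⟨hv0t, hR3, hRup, hY⟩

end Summit.NavierStokesRegularity.NavierStokesRegularity.Theorems.PerpetualPumpCircuitPump
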